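import Summits.CriticalPhenomena.PercolationContinuityZ3.Theorems.PercNearOneGluingNoHeavyLowerTailAPLVwEasy
import HarnessLib

/-!
# `NoHeavyLowerTail` (stmt-CriticalPhenomena-4575) — the signed forms (N1), (NEG-signed), (PV-signed) FAIL:
# arithmetic certificates on the theta graph `K_{2,65}` at `p = ½`

Support file (prover prim-ineq-gen-8 gen 45; `--supports stmt-CriticalPhenomena-4575`; memo
run/shared/lean/prim/prim-ineq-gen-8/FINDING-gen45-SERIES.md §5, script `code-g45/num/counterexample_K2n.py`).
No definitions, no named facts, no sorries.

THE GRAPH.  `K_{2,n}`: two hubs `y` (the glued apex `s` of `…APLVwEasy.lean`) and `v`, joined by `n` internally disjoint paths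
`y – x_i – v`, every edge open with probability `z` independently; loads `u_i` on the middle vertices, `s` on `y`, `t` on `v`.
Because the branches are independent and, on `{y ↮ v}`, no branch is fully open, every quantity in the per-vertex inequalities is
an elementary closed form (`ρ := 1 − z²`):
  `q := P(y↮v) = ρⁿ`, `τ := 1 − q`,
  `A := P(x_i ∈ C_y, y↮v) = z(1−z)ρⁿ⁻¹ (= P(x_i ∈ C_v, y↮v))`,
  `C := P(x_i ∈ C_y, y↔v) = z + (1−z)z(1−ρⁿ⁻¹) − A`,
  `D := P(x_i ∈ C_y, x_j ∈ C_v, y↮v) = z²(1−z)²ρⁿ⁻² (i ≠ j)`, and `0` for `i = j`;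
hence with `S = Σu_i`, `S₂ = Σu_i²`, `U = ℓ(C_y)`, `W = ℓ(C_v)`:
  `E U = s + τt + (A+C)S`, `E W = t + τs + (A+C)S`, `E[U; y↔v] = τ(s+t) + CS`, `E[W; y↮v] = qt + AS`,
  `E[UW; y↮v] = qst + AS(s+t) + D(S² − S₂)`.
(These closed forms are checked against exhaustive enumeration of the `2n` edges for `n = 2, 3`, and the resulting quadratic form
against the brute-force (N1) matrix for `n ≤ 6`, in the script; they are documented here, not kernel statements.)

THE CERTIFICATES (pure arithmetic, `norm_num`), at `z = ½`, `n = 65`, `u_i = 1` (so `S = S₂ = 65`), `s = t = −195/8`: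
* `n1_fails_theta65_arith`:  `E U · E W − E[UW; y↮v] < 0` — the apex-free master form (N1) of memo gen 44 §2e
  (`E[ℓ(C_y)ℓ(C_v); y↮v] ≤ Eℓ(C_y)·Eℓ(C_v)` for all real `ℓ`) is FALSE (value `≈ −8.54·10⁻¹⁰`);
* `neg_signed_fails_theta65_arith`: `Γ = E U·E[W;y↮v] − E[UW;y↮v] < 0` with no load on the apex — (NEG-signed)
  (`Sym K ⪰ 0`, i.e. `Cov(ℓ(C_S), 1[S↮v]ℓ(C_v)) ≤ 0` for signed `ℓ`) is FALSE;
* `pv_signed_fails_theta65_arith`: `2p_vΓ − N² < 0` (`N = E[U;y↔v] − τ·E U`) — (PV-signed) (`2p_v Sym K ⪰ c cᵀ`) and the apex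
  form `H2` of `…APLVwSeries.lean` are FALSE.
The violations are of relative size `10⁻⁹` and need `n ≥ 64` parallel branches (at `z = ½`; `τ = 1 − (3/4)ⁿ`), far outside the
range `n ≤ 9` of the > 5·10⁶ exact tests of gen 44 — they were found through the exact composition calculus of
`…APLVwSeries.lean` (memo §4–§5: the parallel composition of `h_min` is a 2×2 recursion whose 64-fold iterate on the path `P₂`
turns negative).  With NONNEGATIVE loads (`t ≥ 0`) the same family satisfies (PV) with margin (`N²/(2p_vΓ) ≤ 0.65`): the per-vertex
inequality (PV) of gen 42/44 for `ℓ ≥ 0` — the one (V_w) needs — is NOT refuted; it is a copositivity statement, not a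
positive-semidefiniteness one. [this work]
-/

noncomputable section

namespace Summit.CriticalPhenomena.PercolationContinuityZ3.Theorems

namespace APL

/-- **(N1) fails on `K_{2,65}`, `p = ½` (arithmetic certificate).**  With the closed forms of the module docstring at `z = ½`,
`n = 65` (`q = (3/4)^65`, `τ = 1 − q`, `A = ¼(3/4)^64`, `C = ¾ − ½(3/4)^64`, `D = (1/16)(3/4)^63`), loads `u_i = 1`
(`S = S₂ = 65`) and `s = t = −195/8` on the two hubs:  `E U · E W − E[UW; y↮v] < 0`. [this work] -/
theorem n1_fails_theta65_arith :
    let q : ℝ := (3 / 4) ^ 65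
    let τ : ℝ := 1 - (3 / 4) ^ 65
    let A : ℝ := 1 / 4 * (3 / 4) ^ 64
    let C : ℝ := 3 / 4 - 1 / 2 * (3 / 4) ^ 64
    let D : ℝ := 1 / 16 * (3 / 4) ^ 63
    let S : ℝ := 65
    let s : ℝ := -195 / 8
    (s + τ * s + (A + C) * S) * (s + τ * s + (A + C) * S) - (q * s * s + A * S * (s + s) + D * (S * S - S)) < 0 := by
  norm_num

/-- **(NEG-signed) fails on `K_{2,65}`, `p = ½` (arithmetic certificate).**  Same closed forms, loads `u_i = 1`, `t = −195/8` on
`v`, nothing on the apex:  `Γ = E U · E[W; y↮v] − E[UW; y↮v] = (τt + (A+C)S)(qt + AS) − (tAS + D(S²−S₂)) < 0`, i.e.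
`Cov(ℓ(C_y), 1[y↮v]ℓ(C_v)) > 0` for this signed load. [this work] -/
theorem neg_signed_fails_theta65_arith :
    let q : ℝ := (3 / 4) ^ 65
    let τ : ℝ := 1 - (3 / 4) ^ 65
    let A : ℝ := 1 / 4 * (3 / 4) ^ 64
    let C : ℝ := 3 / 4 - 1 / 2 * (3 / 4) ^ 64
    let D : ℝ := 1 / 16 * (3 / 4) ^ 63
    let S : ℝ := 65
    let t : ℝ := -195 / 8
    (τ * t + (A + C) * S) * (q * t + A * S) - (t * A * S + D * (S * S - S)) < 0 := by
  norm_num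

/-- **(PV-signed) and `H2` fail on `K_{2,65}`, `p = ½` (arithmetic certificate).**  Same data; with `N = E[U; y↔v] − τ·E U =
(C S + τt) − τ(τt + (A+C)S)` and `Γ` as in `neg_signed_fails_theta65_arith`:  `2τΓ − N² < 0`, i.e. `N² > 2p_vΓ` at the signed
load (`u_i = 1`, `t = −195/8` on `v`) — the opposite of (PV).  (With `t ≥ 0` the family satisfies (PV).) [this work] -/
theorem pv_signed_fails_theta65_arith :
    let q : ℝ := (3 / 4) ^ 65
    let τ : ℝ := 1 - (3 / 4) ^ 65
    let A : ℝ := 1 / 4 * (3 / 4) ^ 64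
    let C : ℝ := 3 / 4 - 1 / 2 * (3 / 4) ^ 64
    let D : ℝ := 1 / 16 * (3 / 4) ^ 63
    let S : ℝ := 65
    let t : ℝ := -195 / 8
    2 * τ * ((τ * t + (A + C) * S) * (q * t + A * S) - (t * A * S + D * (S * S - S)))
      - ((C * S + τ * t) - τ * (τ * t + (A + C) * S)) ^ 2 < 0 := by
  norm_num

end APL

end Summit.CriticalPhenomena.PercolationContinuityZ3.Theorems
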